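import Literature.NumberTheory.EllipticCurves.HeegnerPointsKolyvaginPrimaryOrderTelescopeDivisibleProofs
import Literature.NumberTheory.EllipticCurves.HeegnerPointsKolyvaginPrimaryOrderLiftProofs
import Literature.GroupTheory.FiniteAbelian.SymplecticModulesInvolution
import Literature.GroupTheory.FiniteAbelian.IndependentGenerators
import HarnessLib

/-!
# Kolyvagin's bound REFINED by global divisibility: `#Ш(E/K)[p^∞] ≤ p^{2(M₀ − t)}` from the descent
# data (McCallum 1991 Cor. 5.6 read as `∑ Nᵢ ≤ M₀ − m`; Jetchev 2008 (1), Cor. 1.5)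

Sibling proof file of `HeegnerPointsKolyvaginPrimaryOrderProofs` (Kolyvagin's `#Ш(E/K)_{p^M} ≤ p^{2M₀}`,
McCallum 1991 §1 Theorem, order form) and of `HeegnerPointsKolyvaginPrimaryOrderTelescopeDivisibleProofs`
(the telescope `∑ Nᵢ + t ≤ M₀` under global divisibility of the top Kolyvagin class). Theorems only:
**no definition and no named fact is introduced** (D-0026). Written by the cell `bsd-stepL` (seat
`bsd-stepL-tam3-p1` g9, crux item stmt-BirchSwinnertonDyer-19109 `EulerHalvesAtThree`) towards a kernel
form of the named fact `McCallum1991_padicValNat_card_sha_primary_add_le_of_globalDivisibility`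
(`KolyvaginShaStructureDivisibility.lean`: `ord_p #Ш(E/K)[p^∞] + 2t ≤ 2M₀` under global divisibility of
the derived Heegner points to depth `t` — the "Tamagawa-absorbing" half of Kolyvagin–McCallum–Jetchev).

## What is proved

For Kolyvagin's descent data `S : HypothesesM V Pl` on `V = H¹(K, E_{p^M})` with a finite Selmer group
carrying an alternating, `τ`-invariant, bi-additive `ℚ/ℤ`-valued pairing `P` vanishing against `x` and
non-degenerate modulo `ℤx` (the Cassels–Tate pairing of `Ш(E/K)_{p^M} = Sel/ℤx` pulled back), McCallum's
value formula `hCTV` (Prop. 4.7 / Lemma 5.3 / Prop. 4.4) and Čebotarev in kernel form `hCeb` (Prop. 3.1),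
`p^{E₀} Sel ⊆ ℤx` with `E₀ + M₀ ≤ M`, AND the divisibility `hdiv`: every Kolyvagin class `c_M(n)` of a
square-free Kolyvagin product `n` is killed by `p^{M−t}` (`t ≤ M`; for the Heegner datum: every derived
point `P_n`, `n ∈ S(M)`, is `p^t`-divisible in `E(K_n)` — McCallum's `min_r M_r ≥ t`):

  `KolyvaginDescent.HypothesesM.card_sel_le_of_casselsTate_of_pow_smul_c_eq_zero`:
  **`#S_{p^M}(E/K) ≤ p^M · p^{2(M₀ − t)}`**, i.e. `#Ш(E/K)_{p^M} = #(Sel/ℤx) ≤ p^{2(M₀ − t)}`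
  (`card_quotient_le_of_casselsTate_of_pow_smul_c_eq_zero`).

## Proof

VERBATIM the sibling's (`Q = Sel/ℤx ≃ (L₊ × L₋)²` by the symplectic structure theorem, pure eigen-lifts
of independent generators interleaved as McCallum's `D^{-ε} = D₁ × D₃ × ⋯`, `D^{ε} = D₂ × D₄ × ⋯`), with
the telescope `sum_expo_le_M₀_of_casselsTate` replaced by its divisible refinement
`sum_expo_add_le_M₀_of_casselsTate_of_pow_smul_c_eq_zero` (`∑ expo sᵢ + t ≤ M₀`), so that
`#L₊ · #L₋ = p^{∑ expo sᵢ} ≤ p^{M₀ − t}`. The private bookkeeping lemmas of the sibling are repeated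
(they are private there).

## References

* W. G. McCallum, *Kolyvagin's work on Shafarevich–Tate groups*, in *`L`-functions and arithmetic
  (Durham, 1989)*, LMS Lecture Note Ser. 153, CUP (1991), 295–316: §1 Theorem, §5 Lemma 5.1, Thm. 5.4
  (proof, p. 312), Cor. 5.5, Cor. 5.6. [McCallumLMS1991]
* D. Jetchev, *Global divisibility of Heegner points and Tamagawa numbers*, Compos. Math. 144 (2008),
  p. 812 (1) and Cor. 1.5. [Jetchev2008]
* V. A. Kolyvagin, *On the structure of Shafarevich–Tate groups*, LNM 1479 (1991), 94–121 (cite only).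
-/

open scoped Classical

namespace Literature.NumberTheory.EllipticCurves

namespace KolyvaginDescent

namespace HypothesesM

open Literature.GroupTheory.FiniteAbelian

variable {V : Type*} [AddCommGroup V] {Pl : Type*} (S : HypothesesM V Pl)

/-! ### Orders and interleaved sums -/

/-- `ord s = p^{expo s}`. [folklore] -/
private theorem addOrderOf_eq_pow_expo (s : V) : addOrderOf s = S.p ^ S.expo s := by
  by_cases h : S.expo s = 0
  · have hs : s = 0 := by
      have := S.pow_expo_zsmul s
      rwa [h, pow_zero, one_smul] at this
    rw [h, pow_zero, hs, addOrderOf_zero]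
  · exact addOrderOf_eq_prime_pow S.hp (S.pow_expo_zsmul s) (S.pow_expo_sub_one_zsmul_ne_zero h)

/-- Splitting a sum over `1 ≤ i ≤ 2m` into odd and even indices. [folklore] -/
private theorem sum_Ioc_two_mul {A : Type*} [AddCommMonoid A] (f : ℕ → A) (m : ℕ) :
    ∑ i ∈ Finset.Ioc 0 (2 * m), f i =
      ∑ j ∈ Finset.range m, f (2 * j + 1) + ∑ j ∈ Finset.range m, f (2 * j + 2) := by
  induction m with
  | zero => simp
  | succ m ih =>
    rw [show 2 * (m + 1) = 2 * m + 1 + 1 from rfl, Finset.sum_Ioc_succ_top (by omega),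
      Finset.sum_Ioc_succ_top (by omega), ih, Finset.sum_range_succ, Finset.sum_range_succ]
    abel

/-- A pure class modulo `ℤx` with `p^{E₀} Sel ⊆ ℤx` has `expo ≤ E₀`. [folklore] -/
private theorem expo_le_of_pure {E₀ : ℕ} {w : V} (hw : w ∈ S.Sel)
    (hkill : ∀ t ∈ S.Sel, ((S.p : ℤ) ^ E₀) • t ∈ AddSubgroup.zmultiples S.x)
    (hpure : ∀ a : ℤ, a • w ∈ AddSubgroup.zmultiples S.x → a • w = 0) : S.expo w ≤ E₀ :=
  S.expo_le_of_pow_zsmul_eq_zero (hpure _ (hkill w hw))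

/-- A pure class has the same order as its image in `Sel/ℤx`. [folklore] -/
private theorem addOrderOf_mk_eq_of_pure {w : V} (hw : w ∈ S.Sel)
    (hpure : ∀ a : ℤ, a • w ∈ AddSubgroup.zmultiples S.x → a • w = 0) :
    addOrderOf (QuotientAddGroup.mk ⟨w, hw⟩ :
      S.Sel ⧸ (AddSubgroup.zmultiples S.x).addSubgroupOf S.Sel) = S.p ^ S.expo w := by
  rw [← S.addOrderOf_eq_pow_expo w, addOrderOf_eq_addOrderOf_iff]
  intro n
  rw [← QuotientAddGroup.mk_nsmul, S.quotient_mk_eq_zero_iff, AddSubgroupClass.coe_nsmul,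
    ← natCast_zsmul]
  exact ⟨fun h ↦ hpure _ h, fun h ↦ by rw [h]; exact zero_mem _⟩

/-! ### Kolyvagin's bound, refined by global divisibility -/

/-- **Kolyvagin's bound on the order of `Ш(E/K)_{p^∞}` REFINED by global divisibility (McCallum 1991
Cor. 5.6 read as `∑ Nᵢ ≤ M₀ − t`; Jetchev 2008 (1)), modulo `p^M`.** The sibling
`card_sel_le_of_casselsTate` VERBATIM with the extra hypothesis `hdiv` (every Kolyvagin class `c_M(n)` is
killed by `p^{M−t}`, `t ≤ M`) and the telescope replaced by its divisible refinement; original wording: Let `S` be Kolyvagin's descent data on `H¹(K, E_{p^M})` with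
`Sel = S_{p^M}(E/K)` finite, and let `P` be a bi-additive `ℚ/ℤ`-valued pairing on `Sel` which is
alternating, `τ`-invariant, vanishes against `x = δ_M x₀` and is non-degenerate modulo `ℤx` — the
Cassels–Tate pairing of `Ш(E/K)_{p^M} = Sel/ℤx` — satisfying the value formula `hCTV`
(Prop. 4.7 with Lemma 5.3 and Prop. 4.4, order language) and Čebotarev in kernel form `hCeb`
(Prop. 3.1). If `p^{E₀} Sel ⊆ ℤx` with `E₀ + M₀ ≤ M` (Kolyvagin's annihilator `E₀ = M₀` at a
level `M ≥ 2M₀`), then **`#Sel ≤ p^M · p^{2(M₀ − t)}`**, i.e. `#Ш(E/K)_{p^M} ≤ p^{2(M₀ − t)}`.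
[cite: Jetchev2008, p. 812 (1) and Cor. 1.5]
[cite: McCallumLMS1991, §1 Theorem; Thm. 5.4 (proof, p. 312), Cor. 5.6; Prop. 3.1, Prop. 4.7,
Lemma 5.3] -/
theorem card_sel_le_of_casselsTate_of_pow_smul_c_eq_zero [Finite S.Sel] (P : S.Sel →+ S.Sel →+ AddCircle (1 : ℚ))
    (halt : ∀ z, P z z = 0)
    (hPτ : ∀ z t : S.Sel, P ⟨S.τ z, S.τ_mem z z.2⟩ ⟨S.τ t, S.τ_mem t t.2⟩ = P z t)
    (hPx : ∀ t, P ⟨S.x, S.x_mem⟩ t = 0)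
    (hnd : ∀ z : S.Sel, (∀ t, P z t = 0) → (z : V) ∈ AddSubgroup.zmultiples S.x)
    (hCTV : ∀ ℓ m : ℕ, S.Kol ℓ → KolSupp S.Kol (ℓ * m) → ¬ ℓ ∣ m →
      ∀ (j N a b : ℕ) (t : V) (ht : t ∈ S.Sel) (hz : ((S.p : ℤ) ^ j) • S.c (ℓ * m) ∈ S.Sel),
      ((S.p : ℤ) ^ N) • t = 0 → S.τ t = (S.ε * (-1) ^ (ℓ * m).primeFactors.card) • t →
      (∀ q ∈ m.primeFactors, t ∈ S.A q) → S.M - S.M₀ ≤ j → N + S.M₀ ≤ S.M → N ≤ j → a + b + 1 = N →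
      ((S.p : ℤ) ^ (a + (j - N))) • S.c m ∉ S.A ℓ → ((S.p : ℤ) ^ b) • t ∉ S.A ℓ →
      P ⟨_, hz⟩ ⟨t, ht⟩ ≠ 0)
    (hCeb : ∀ (T : Finset V) (g₁ g₂ : V) (ν : ℤ), (ν = 1 ∨ ν = -1) → S.τ g₁ = ν • g₁ →
      S.τ g₂ = (-ν) • g₂ → (∀ t ∈ T, ∃ e : ℤ, (e = 1 ∨ e = -1) ∧ S.τ t = e • t) → ∀ b : ℕ,
      ∃ ℓ, b < ℓ ∧ S.Kol ℓ ∧ ∀ g ∈ AddSubgroup.closure (insert g₁ (insert g₂ (T : Set V))),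
        g ∈ S.A ℓ ↔ g ∈ AddSubgroup.closure (T : Set V))
    {E₀ : ℕ} (hkill : ∀ t ∈ S.Sel, ((S.p : ℤ) ^ E₀) • t ∈ AddSubgroup.zmultiples S.x)
    (hE : E₀ + S.M₀ ≤ S.M) (t : ℕ) (htM : t ≤ S.M)
    (hdiv : ∀ n : ℕ, KolSupp S.Kol n → ((S.p : ℤ) ^ (S.M - t)) • S.c n = 0) :
    Nat.card S.Sel ≤ S.p ^ S.M * S.p ^ (2 * (S.M₀ - t)) := by
  classical
  have hp := S.hp
  -- ### skew-symmetry; `P z x = 0`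
  have hskew : ∀ z t, P z t = -P t z := fun z t ↦ by
    have h := halt (z + t)
    simp only [map_add, AddMonoidHom.add_apply, halt, zero_add, add_zero] at h
    exact eq_neg_of_add_eq_zero_right h
  have hPx' : ∀ z, P z ⟨S.x, S.x_mem⟩ = 0 := fun z ↦ by rw [hskew, hPx, neg_zero]
  -- ### the quotient `Q = Sel/ℤx` with its involution and pairing
  obtain ⟨τQ, hτQ, hτQτ⟩ := S.exists_quotient_involution
  obtain ⟨B, hB⟩ := S.exists_quotient_pairing P hPx hPx'
  have haltB : ∀ q, B q q = 0 := fun q ↦ by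
    induction q using QuotientAddGroup.induction_on with
    | H z => rw [hB, halt]
  have hndB : ∀ q, (∀ r, B q r = 0) → q = 0 := by
    intro q hq
    induction q using QuotientAddGroup.induction_on with
    | H z =>
      rw [S.quotient_mk_eq_zero_iff]
      exact hnd z fun t ↦ by rw [← hB]; exact hq _
  have hBτ : ∀ q r, B (τQ q) (τQ r) = B q r := by
    intro q r
    induction q using QuotientAddGroup.induction_on with
    | H z =>
      induction r using QuotientAddGroup.induction_on with
      | H t => rw [hτQ, hτQ, hB, hB, hPτ]
  have hodd := S.odd_card_quotient
  obtain ⟨Lp, Lm, hLp, hLm, hisoL, hcp, hcm, -, -⟩ :=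
    exists_isotropic_addEquiv_prod_self_eigenspaces B haltB hndB τQ hτQτ hBτ hodd
  have hcompl := isCompl_ker_sub_id_ker_add_id τQ hτQτ hodd
  have hQcard : Nat.card (S.Sel ⧸ (AddSubgroup.zmultiples S.x).addSubgroupOf S.Sel) =
      Nat.card Lp ^ 2 * Nat.card Lm ^ 2 := by
    rw [card_eq_mul_of_isCompl hcompl, hcp, hcm]
  -- ### sign bookkeeping: `La` (sign `-ε`, odd positions), `Lb` (sign `ε`, even positions)
  obtain ⟨La, Lb, hLa, hLb, hisoab, hdisj, hcardab⟩ :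
      ∃ La Lb : AddSubgroup (S.Sel ⧸ (AddSubgroup.zmultiples S.x).addSubgroupOf S.Sel),
        (∀ q ∈ La, τQ q = (-S.ε) • q) ∧ (∀ q ∈ Lb, τQ q = S.ε • q) ∧
        (∀ a ∈ La ⊔ Lb, ∀ b ∈ La ⊔ Lb, B a b = 0) ∧ Disjoint La Lb ∧
        Nat.card (S.Sel ⧸ (AddSubgroup.zmultiples S.x).addSubgroupOf S.Sel) =
          Nat.card La ^ 2 * Nat.card Lb ^ 2 := by
    have hp1 : ∀ q ∈ Lp, τQ q = (1 : ℤ) • q := fun q hq ↦ by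
      have := hLp hq
      rw [AddMonoidHom.mem_ker, AddMonoidHom.sub_apply, AddMonoidHom.id_apply, sub_eq_zero] at this
      rw [this, one_smul]
    have hm1 : ∀ q ∈ Lm, τQ q = (-1 : ℤ) • q := fun q hq ↦ by
      have := hLm hq
      rw [AddMonoidHom.mem_ker, AddMonoidHom.add_apply, AddMonoidHom.id_apply] at this
      rw [neg_one_zsmul, eq_neg_of_add_eq_zero_left this]
    have hdj : Disjoint Lp Lm := hcompl.disjoint.mono hLp hLm
    rcases S.hε with h | h
    · refine ⟨Lm, Lp, fun q hq ↦ by rw [h]; exact hm1 q hq, fun q hq ↦ by rw [h]; exact hp1 q hq,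
        fun a ha b hb ↦ hisoL a (sup_comm Lm Lp ▸ ha) b (sup_comm Lm Lp ▸ hb), hdj.symm, ?_⟩
      rw [hQcard, mul_comm]
    · refine ⟨Lp, Lm, fun q hq ↦ by rw [h, neg_neg]; exact hp1 q hq,
        fun q hq ↦ by rw [h]; exact hm1 q hq, hisoL, hdj, hQcard⟩
  -- ### generators of `La`, `Lb` of a common length `m`
  obtain ⟨ma, ga, hga⟩ := exists_indep_prod_addOrderOf_eq_card_le (G := La)
  obtain ⟨mb, gb, hgb⟩ := exists_indep_prod_addOrderOf_eq_card_le (G := Lb)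
  obtain ⟨hgaind, hgacard⟩ := hga (max ma mb) (le_max_left _ _)
  obtain ⟨hgbind, hgbcard⟩ := hgb (max ma mb) (le_max_right _ _)
  set m := max ma mb with hm
  -- ### pure eigen-lifts
  have hlift : ∀ (ν : ℤ), (ν = 1 ∨ ν = -1) →
      ∀ q : S.Sel ⧸ (AddSubgroup.zmultiples S.x).addSubgroupOf S.Sel, τQ q = ν • q →
      ∃ w : V, ∃ hw : w ∈ S.Sel, (QuotientAddGroup.mk ⟨w, hw⟩ :
          S.Sel ⧸ (AddSubgroup.zmultiples S.x).addSubgroupOf S.Sel) = q ∧ S.τ w = ν • w ∧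
        ∀ a : ℤ, a • w ∈ AddSubgroup.zmultiples S.x → a • w = 0 := by
    intro ν hν q hq
    obtain ⟨z, rfl⟩ := QuotientAddGroup.mk_surjective q
    have hτz : S.τ z - ν • (z : V) ∈ AddSubgroup.zmultiples S.x := by
      have h1 : (QuotientAddGroup.mk (⟨S.τ z, S.τ_mem z z.2⟩ - ν • z) :
          S.Sel ⧸ (AddSubgroup.zmultiples S.x).addSubgroupOf S.Sel) = 0 := by
        rw [QuotientAddGroup.mk_sub, QuotientAddGroup.mk_zsmul, ← hτQ, hq, sub_self]
      rw [S.quotient_mk_eq_zero_iff] at h1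
      simpa using h1
    obtain ⟨w, hwS, hwz, hτw, hpure⟩ := S.exists_pure_eigen_lift z.2 hν hτz
    refine ⟨w, hwS, ?_, hτw, hpure⟩
    rw [QuotientAddGroup.eq_iff_sub_mem, AddSubgroup.mem_addSubgroupOf]
    simpa using hwz
  have hνa : -S.ε = 1 ∨ -S.ε = -1 := S.neg_ε_sign
  choose u huS humk hτu hpu using fun j ↦ hlift (-S.ε) hνa (ga j : _) (hLa _ (ga j).2)
  choose v hvS hvmk hτv hpv using fun j ↦ hlift S.ε S.hε (gb j : _) (hLb _ (gb j).2)
  -- isotropy of all lifts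
  have hmem_sup_u : ∀ j, (QuotientAddGroup.mk ⟨u j, huS j⟩ :
      S.Sel ⧸ (AddSubgroup.zmultiples S.x).addSubgroupOf S.Sel) ∈ La ⊔ Lb := fun j ↦ by
    rw [humk]; exact AddSubgroup.mem_sup_left (ga j).2
  have hmem_sup_v : ∀ j, (QuotientAddGroup.mk ⟨v j, hvS j⟩ :
      S.Sel ⧸ (AddSubgroup.zmultiples S.x).addSubgroupOf S.Sel) ∈ La ⊔ Lb := fun j ↦ by
    rw [hvmk]; exact AddSubgroup.mem_sup_right (gb j).2
  -- ### the interleaved family `s_{2j+1} = u_j`, `s_{2j+2} = v_j`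
  let s : ℕ → V := fun i ↦ if i % 2 = 1 then u (i / 2) else v (i / 2 - 1)
  have hs_odd : ∀ j, s (2 * j + 1) = u j := fun j ↦ by
    have h1 : (2 * j + 1) % 2 = 1 := by omega
    have h2 : (2 * j + 1) / 2 = j := by omega
    simp only [s, h1, if_true, h2]
  have hs_even : ∀ j, s (2 * j + 2) = v j := fun j ↦ by
    have h1 : ¬ ((2 * j + 2) % 2 = 1) := by omega
    have h2 : (2 * j + 2) / 2 - 1 = j := by omega
    simp only [s, h1, if_false, h2]
  have hsel : ∀ i, s i ∈ S.Sel := fun i ↦ by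
    simp only [s]
    split_ifs
    exacts [huS _, hvS _]
  have hspure : ∀ i (a : ℤ), a • s i ∈ AddSubgroup.zmultiples S.x → a • s i = 0 := fun i ↦ by
    simp only [s]
    split_ifs
    exacts [hpu _, hpv _]
  have hsmk : ∀ i, (QuotientAddGroup.mk ⟨s i, hsel i⟩ :
      S.Sel ⧸ (AddSubgroup.zmultiples S.x).addSubgroupOf S.Sel) ∈ La ⊔ Lb := fun i ↦ by
    have : ∀ (w : V) (h₁ h₂ : w ∈ S.Sel), (⟨w, h₁⟩ : S.Sel) = ⟨w, h₂⟩ := fun _ _ _ ↦ rfl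
    by_cases hi : i % 2 = 1
    · have : (⟨s i, hsel i⟩ : S.Sel) = ⟨u (i / 2), huS _⟩ := Subtype.ext (by simp [s, hi])
      rw [this]; exact hmem_sup_u _
    · have : (⟨s i, hsel i⟩ : S.Sel) = ⟨v (i / 2 - 1), hvS _⟩ := Subtype.ext (by simp [s, hi])
      rw [this]; exact hmem_sup_v _
  -- parity of indices in `(0, 2m]`
  have hparity : ∀ i ∈ Finset.Ioc 0 (2 * m),
      (∃ j < m, i = 2 * j + 1) ∨ (∃ j < m, i = 2 * j + 2) := by
    intro i hi
    simp only [Finset.mem_Ioc] at hi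
    rcases Nat.even_or_odd i with ⟨j, hj⟩ | ⟨j, hj⟩
    · right; exact ⟨j - 1, by omega, by omega⟩
    · left; exact ⟨j, by omega, by omega⟩
  -- ### the hypotheses of the telescope
  have hτs : ∀ i ∈ Finset.Ioc 0 (2 * m), S.τ (s i) = (S.ε * (-1) ^ i) • s i := by
    intro i hi
    rcases hparity i hi with ⟨j, -, rfl⟩ | ⟨j, -, rfl⟩
    · rw [hs_odd, hτu, pow_succ, pow_mul, neg_one_sq, one_pow, one_mul, mul_neg_one]
    · rw [hs_even, hτv, show 2 * j + 2 = 2 * (j + 1) by ring, pow_mul, neg_one_sq, one_pow,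
        mul_one]
  have hiso : ∀ i ∈ Finset.Ioc 0 (2 * m), ∀ i' ∈ Finset.Ioc 0 (2 * m),
      P ⟨s i, hsel i⟩ ⟨s i', hsel i'⟩ = 0 := fun i _ i' _ ↦ by
    rw [← hB]; exact hisoab _ (hsmk i) _ (hsmk i')
  have hQind : ∀ a : ℕ → ℤ, (∑ i ∈ Finset.Ioc 0 (2 * m), a i • s i) ∈ AddSubgroup.zmultiples S.x →
      ∀ i ∈ Finset.Ioc 0 (2 * m), a i • s i ∈ AddSubgroup.zmultiples S.x := by
    intro a ha i hi
    -- push the relation to `Q`: `∑ a_{2j+1} ga_j + ∑ a_{2j+2} gb_j = 0` in `La ⊕ Lb`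
    have hsum := sum_Ioc_two_mul (fun i ↦ a i • s i) m
    simp only [hs_odd, hs_even] at hsum
    have hQ0 : (QuotientAddGroup.mk ⟨∑ i ∈ Finset.Ioc 0 (2 * m), a i • s i,
        S.Sel.sum_mem fun i _ ↦ S.Sel.zsmul_mem (hsel i) _⟩ :
        S.Sel ⧸ (AddSubgroup.zmultiples S.x).addSubgroupOf S.Sel) = 0 := by
      rw [S.quotient_mk_eq_zero_iff]; exact ha
    have hA : (⟨∑ i ∈ Finset.Ioc 0 (2 * m), a i • s i,
        S.Sel.sum_mem fun i _ ↦ S.Sel.zsmul_mem (hsel i) _⟩ : S.Sel) =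
        ∑ j ∈ Finset.range m, a (2 * j + 1) • ⟨u j, huS j⟩ +
          ∑ j ∈ Finset.range m, a (2 * j + 2) • ⟨v j, hvS j⟩ := by
      apply Subtype.ext
      simp only [hsum, AddSubgroup.coe_add, AddSubgroup.val_finsetSum, AddSubgroupClass.coe_zsmul]
    rw [hA, QuotientAddGroup.mk_add, QuotientAddGroup.mk_sum, QuotientAddGroup.mk_sum] at hQ0
    simp only [QuotientAddGroup.mk_zsmul, humk, hvmk] at hQ0
    -- the two partial sums lie in `La` and `Lb`, which are disjoint
    have hAmem : (∑ j ∈ Finset.range m, a (2 * j + 1) • (ga j :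
        S.Sel ⧸ (AddSubgroup.zmultiples S.x).addSubgroupOf S.Sel)) ∈ La :=
      La.sum_mem fun j _ ↦ La.zsmul_mem (ga j).2 _
    have hBmem : (∑ j ∈ Finset.range m, a (2 * j + 2) • (gb j :
        S.Sel ⧸ (AddSubgroup.zmultiples S.x).addSubgroupOf S.Sel)) ∈ Lb :=
      Lb.sum_mem fun j _ ↦ Lb.zsmul_mem (gb j).2 _
    have hA0 : ∑ j ∈ Finset.range m, a (2 * j + 1) • (ga j :
        S.Sel ⧸ (AddSubgroup.zmultiples S.x).addSubgroupOf S.Sel) = 0 := by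
      refine (AddSubgroup.disjoint_def.mp hdisj) hAmem ?_
      rw [eq_neg_of_add_eq_zero_left hQ0]
      exact Lb.neg_mem hBmem
    have hB0 : ∑ j ∈ Finset.range m, a (2 * j + 2) • (gb j :
        S.Sel ⧸ (AddSubgroup.zmultiples S.x).addSubgroupOf S.Sel) = 0 := by
      rwa [hA0, zero_add] at hQ0
    -- independence inside `La`, `Lb`
    have hA0' : ∑ j ∈ Finset.range m, a (2 * j + 1) • ga j = 0 := by
      apply Subtype.ext
      simpa only [AddSubgroup.val_finsetSum, AddSubgroupClass.coe_zsmul, ZeroMemClass.coe_zero] using hA0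
    have hB0' : ∑ j ∈ Finset.range m, a (2 * j + 2) • gb j = 0 := by
      apply Subtype.ext
      simpa only [AddSubgroup.val_finsetSum, AddSubgroupClass.coe_zsmul, ZeroMemClass.coe_zero] using hB0
    rcases hparity i hi with ⟨j, hj, rfl⟩ | ⟨j, hj, rfl⟩
    · have h0 := hgaind (fun j ↦ a (2 * j + 1)) hA0' j (Finset.mem_range.mpr hj)
      have h0' : (a (2 * j + 1) • (ga j : S.Sel ⧸ (AddSubgroup.zmultiples S.x).addSubgroupOf S.Sel))
          = 0 := by
        rw [← AddSubgroupClass.coe_zsmul, h0, ZeroMemClass.coe_zero]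
      rw [← humk, ← QuotientAddGroup.mk_zsmul, S.quotient_mk_eq_zero_iff] at h0'
      rw [hs_odd]
      simpa using h0'
    · have h0 := hgbind (fun j ↦ a (2 * j + 2)) hB0' j (Finset.mem_range.mpr hj)
      have h0' : (a (2 * j + 2) • (gb j : S.Sel ⧸ (AddSubgroup.zmultiples S.x).addSubgroupOf S.Sel))
          = 0 := by
        rw [← AddSubgroupClass.coe_zsmul, h0, ZeroMemClass.coe_zero]
      rw [← hvmk, ← QuotientAddGroup.mk_zsmul, S.quotient_mk_eq_zero_iff] at h0'
      rw [hs_even]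
      simpa using h0'
  have hind := S.indep_of_quotient_indep (m := 2 * m) (s := s)
    (fun i _ a ha ↦ hspure i a ha) hQind
  have hroom : ∀ i ∈ Finset.Ioc 0 (2 * m), S.expo (s i) + S.M₀ ≤ S.M := fun i _ ↦ by
    have := S.expo_le_of_pure (hsel i) hkill (hspure i)
    omega
  -- ### the telescope: `∑ expo sᵢ ≤ M₀`
  have hsum := S.sum_expo_add_le_M₀_of_casselsTate_of_pow_smul_c_eq_zero P hCTV hCeb (2 * m) s hsel hτs
    hiso hind hroom t htM (by omega) (fun n hn _ ↦ hdiv n hn)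
  rw [sum_Ioc_two_mul (fun i ↦ S.expo (s i)) m] at hsum
  simp only [hs_odd, hs_even] at hsum
  -- ### counting: `#Q = (#La #Lb)² = p^{2 ∑ expo}`
  have hordu : ∀ j, addOrderOf (ga j) = S.p ^ S.expo (u j) := fun j ↦ by
    rw [← addOrderOf_injective La.subtype Subtype.val_injective (ga j), AddSubgroup.coe_subtype,
      ← humk, S.addOrderOf_mk_eq_of_pure (huS j) (hpu j)]
  have hordv : ∀ j, addOrderOf (gb j) = S.p ^ S.expo (v j) := fun j ↦ by
    rw [← addOrderOf_injective Lb.subtype Subtype.val_injective (gb j), AddSubgroup.coe_subtype,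
      ← hvmk, S.addOrderOf_mk_eq_of_pure (hvS j) (hpv j)]
  have hcardLa : Nat.card La = S.p ^ ∑ j ∈ Finset.range m, S.expo (u j) := by
    rw [hgacard, Finset.prod_congr rfl fun j _ ↦ hordu j, Finset.prod_pow_eq_pow_sum]
  have hcardLb : Nat.card Lb = S.p ^ ∑ j ∈ Finset.range m, S.expo (v j) := by
    rw [hgbcard, Finset.prod_congr rfl fun j _ ↦ hordv j, Finset.prod_pow_eq_pow_sum]
  rw [S.card_sel_eq, hcardab, hcardLa, hcardLb]
  apply Nat.mul_le_mul_left
  rw [← pow_mul, ← pow_mul, ← pow_add]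
  exact Nat.pow_le_pow_right hp.pos (by omega)

/-- **Kolyvagin's refined bound, quotient form**: under the hypotheses of
`card_sel_le_of_casselsTate_of_pow_smul_c_eq_zero`, `#(Sel/ℤx) ≤ p^{2(M₀ − t)}`, i.e.
`#Ш(E/K)_{p^M} ≤ p^{2(ord_p [E(K) : ℤ y_K] − t)}`.
[cite: McCallumLMS1991, §1 Theorem; Cor. 5.6] [cite: Jetchev2008, p. 812 (1) and Cor. 1.5] -/
theorem card_quotient_le_of_casselsTate_of_pow_smul_c_eq_zero [Finite S.Sel] (P : S.Sel →+ S.Sel →+ AddCircle (1 : ℚ))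
    (halt : ∀ z, P z z = 0)
    (hPτ : ∀ z t : S.Sel, P ⟨S.τ z, S.τ_mem z z.2⟩ ⟨S.τ t, S.τ_mem t t.2⟩ = P z t)
    (hPx : ∀ t, P ⟨S.x, S.x_mem⟩ t = 0)
    (hnd : ∀ z : S.Sel, (∀ t, P z t = 0) → (z : V) ∈ AddSubgroup.zmultiples S.x)
    (hCTV : ∀ ℓ m : ℕ, S.Kol ℓ → KolSupp S.Kol (ℓ * m) → ¬ ℓ ∣ m →
      ∀ (j N a b : ℕ) (t : V) (ht : t ∈ S.Sel) (hz : ((S.p : ℤ) ^ j) • S.c (ℓ * m) ∈ S.Sel),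
      ((S.p : ℤ) ^ N) • t = 0 → S.τ t = (S.ε * (-1) ^ (ℓ * m).primeFactors.card) • t →
      (∀ q ∈ m.primeFactors, t ∈ S.A q) → S.M - S.M₀ ≤ j → N + S.M₀ ≤ S.M → N ≤ j → a + b + 1 = N →
      ((S.p : ℤ) ^ (a + (j - N))) • S.c m ∉ S.A ℓ → ((S.p : ℤ) ^ b) • t ∉ S.A ℓ →
      P ⟨_, hz⟩ ⟨t, ht⟩ ≠ 0)
    (hCeb : ∀ (T : Finset V) (g₁ g₂ : V) (ν : ℤ), (ν = 1 ∨ ν = -1) → S.τ g₁ = ν • g₁ →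
      S.τ g₂ = (-ν) • g₂ → (∀ t ∈ T, ∃ e : ℤ, (e = 1 ∨ e = -1) ∧ S.τ t = e • t) → ∀ b : ℕ,
      ∃ ℓ, b < ℓ ∧ S.Kol ℓ ∧ ∀ g ∈ AddSubgroup.closure (insert g₁ (insert g₂ (T : Set V))),
        g ∈ S.A ℓ ↔ g ∈ AddSubgroup.closure (T : Set V))
    {E₀ : ℕ} (hkill : ∀ t ∈ S.Sel, ((S.p : ℤ) ^ E₀) • t ∈ AddSubgroup.zmultiples S.x)
    (hE : E₀ + S.M₀ ≤ S.M) (t : ℕ) (htM : t ≤ S.M)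
    (hdiv : ∀ n : ℕ, KolSupp S.Kol n → ((S.p : ℤ) ^ (S.M - t)) • S.c n = 0) :
    Nat.card (S.Sel ⧸ (AddSubgroup.zmultiples S.x).addSubgroupOf S.Sel) ≤ S.p ^ (2 * (S.M₀ - t)) := by
  have h := S.card_sel_le_of_casselsTate_of_pow_smul_c_eq_zero P halt hPτ hPx hnd hCTV hCeb hkill hE t
    htM hdiv
  rw [S.card_sel_eq] at h
  exact Nat.le_of_mul_le_mul_left h (pow_pos S.hp.pos _)

end HypothesesM

end KolyvaginDescent

end Literature.NumberTheory.EllipticCurves
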